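import Literature.Probability.RandomPlanarGeometry.RestrictionMeasuresOneBubbleLeaf
import Literature.Probability.RandomPlanarGeometry.BrownianLoopBubble
import HarnessLib

/-!
# [LSW] Thm. 7.3 with interior points: discharge of `exists_isRestrictionMeasure_ae_interior_nonempty`

Proof-only file (no definition, no named fact), after

* G. F. Lawler, O. Schramm, W. Werner, *Conformal restriction: the chordal case*, J. Amer.
  Math. Soc. **16** (2003) 917–955, arXiv:math/0209343 (**[LSW]**), Thm. 7.3 (p. 29: `P_α`,
  `α > 5/8`, is the law of the filling of SLE_κ decorated with a Poisson cloud of Brownian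
  bubbles, `α = (6 − κ)/(2κ)`), with §7.1–7.2 (the bubbles, whose fillings have interior points)
  and p. 5 result 2.

The tree reduced the named fact `exists_isRestrictionMeasure_ae_interior_nonempty` (file
`RestrictionMeasuresBubbles`: for `α > 5/8` some `P_α` is carried by configurations with interior
points) to the existence of the Brownian bubble measure
(`exists_isRestrictionMeasure_ae_interior_nonempty_of_bubble_measure`, file
`RestrictionMeasuresOneBubbleLeaf`); with `exists_isBrownianBubbleMeasure_holds` (file
`BrownianLoopBubble`) it is now a theorem.

## References

* [LSW] Thm. 7.3 (p. 29); §7.1–7.2 (pp. 27–29); p. 5 result 2. [LawlerSchrammWerner2003Restriction]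
-/

noncomputable section

namespace Literature.Probability.RandomPlanarGeometry

/-- **DISCHARGE of `exists_isRestrictionMeasure_ae_interior_nonempty`** — for every `α > 5/8`
there is a two-sided restriction measure of exponent `α` almost every sample of which has an
interior point ([LSW] Thm. 7.3: SLE_κ with a Poisson cloud of Brownian bubbles, filled).
[cite: LawlerSchrammWerner2003Restriction, Thm. 7.3 (p. 29) with §7.1–7.2] -/
theorem exists_isRestrictionMeasure_ae_interior_nonempty_holds :
    exists_isRestrictionMeasure_ae_interior_nonempty :=
  exists_isRestrictionMeasure_ae_interior_nonempty_of_bubble_measure exists_isBrownianBubbleMeasure_holds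

end Literature.Probability.RandomPlanarGeometry

end
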